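import Mathlib

/-!
Crux-triage r1-3, card `null-family-sign-test` (ideator 3): its First lemma `P4P6NullIndefinite`
(IdeatorSketch3.lean, namespace `Summit.QuantumFields.YangMills.Cruxes.ShellRigidity.Ideator3`),
restated verbatim and PROVED — the four sign facts p₄(i d + d') = −2 < 0, p₄(i d + e₂) = 3/2 > 0,
p₆(i d + e₂) = 3/4 > 0, p₆(i e₀ + (e₁+e₂)/√2) = −3/4 < 0 on the two real-null families.
-/

namespace CruxTriage.R1K3

/-- verbatim copy of `Ideator3.P4P6NullIndefinite` -/
def P4P6NullIndefinite : Prop :=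
  let s : ℂ := (Real.sqrt 2 : ℂ)⁻¹
  ((s * (Complex.I + 1)) ^ 4 + (s * (Complex.I - 1)) ^ 4).re < 0 ∧
  0 < ((s * Complex.I) ^ 4 + (s * Complex.I) ^ 4 + (1 : ℂ) ^ 4).re ∧
  0 < ((s * Complex.I) ^ 6 + (s * Complex.I) ^ 6 + (1 : ℂ) ^ 6).re ∧
  (Complex.I ^ 6 + (s : ℂ) ^ 6 + (s : ℂ) ^ 6).re < 0

theorem sq_inv_sqrt_two : ((Real.sqrt 2 : ℝ) : ℂ)⁻¹ ^ 2 = 1 / 2 := by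
  rw [inv_pow, ← Complex.ofReal_pow, Real.sq_sqrt (by norm_num : (0:ℝ) ≤ 2)]
  push_cast
  norm_num

theorem p4p6NullIndefinite_holds : P4P6NullIndefinite := by
  show (((((Real.sqrt 2 : ℝ) : ℂ)⁻¹) * (Complex.I + 1)) ^ 4 +
        ((((Real.sqrt 2 : ℝ) : ℂ)⁻¹) * (Complex.I - 1)) ^ 4).re < 0 ∧
    0 < (((((Real.sqrt 2 : ℝ) : ℂ)⁻¹) * Complex.I) ^ 4 +
        ((((Real.sqrt 2 : ℝ) : ℂ)⁻¹) * Complex.I) ^ 4 + (1 : ℂ) ^ 4).re ∧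
    0 < (((((Real.sqrt 2 : ℝ) : ℂ)⁻¹) * Complex.I) ^ 6 +
        ((((Real.sqrt 2 : ℝ) : ℂ)⁻¹) * Complex.I) ^ 6 + (1 : ℂ) ^ 6).re ∧
    (Complex.I ^ 6 + (((Real.sqrt 2 : ℝ) : ℂ)⁻¹) ^ 6 + (((Real.sqrt 2 : ℝ) : ℂ)⁻¹) ^ 6).re < 0
  set s : ℂ := ((Real.sqrt 2 : ℝ) : ℂ)⁻¹ with hs
  have h2 : s ^ 2 = 1 / 2 := by rw [hs]; exact sq_inv_sqrt_two
  have h4 : s ^ 4 = 1 / 4 := by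
    have : s ^ 4 = (s ^ 2) ^ 2 := by ring
    rw [this, h2]; norm_num
  have h6 : s ^ 6 = 1 / 8 := by
    have : s ^ 6 = (s ^ 2) ^ 3 := by ring
    rw [this, h2]; norm_num
  have hI2 : Complex.I ^ 2 = -1 := Complex.I_sq
  have hI4 : Complex.I ^ 4 = 1 := by
    have : Complex.I ^ 4 = (Complex.I ^ 2) ^ 2 := by ring
    rw [this, hI2]; norm_num
  have hI6 : Complex.I ^ 6 = -1 := by
    have : Complex.I ^ 6 = (Complex.I ^ 2) ^ 3 := by ring
    rw [this, hI2]; norm_num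
  have e1 : (s * (Complex.I + 1)) ^ 4 + (s * (Complex.I - 1)) ^ 4 = ((-2 : ℝ) : ℂ) := by
    have : (s * (Complex.I + 1)) ^ 4 + (s * (Complex.I - 1)) ^ 4
        = s ^ 4 * (2 * ((Complex.I ^ 2) ^ 2 + 6 * Complex.I ^ 2 + 1)) := by ring
    rw [this, h4, hI2]; push_cast; norm_num
  have e2 : (s * Complex.I) ^ 4 + (s * Complex.I) ^ 4 + (1 : ℂ) ^ 4 = ((3 / 2 : ℝ) : ℂ) := by
    have : (s * Complex.I) ^ 4 = s ^ 4 * Complex.I ^ 4 := by ring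
    rw [this, h4, hI4]; push_cast; norm_num
  have e3 : (s * Complex.I) ^ 6 + (s * Complex.I) ^ 6 + (1 : ℂ) ^ 6 = ((3 / 4 : ℝ) : ℂ) := by
    have : (s * Complex.I) ^ 6 = s ^ 6 * Complex.I ^ 6 := by ring
    rw [this, h6, hI6]; push_cast; norm_num
  have e4 : Complex.I ^ 6 + s ^ 6 + s ^ 6 = ((-3 / 4 : ℝ) : ℂ) := by
    rw [hI6, h6]; push_cast; norm_num
  refine ⟨?_, ?_, ?_, ?_⟩
  · rw [e1, Complex.ofReal_re]; norm_num
  · rw [e2, Complex.ofReal_re]; norm_num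
  · rw [e3, Complex.ofReal_re]; norm_num
  · rw [e4, Complex.ofReal_re]; norm_num

end CruxTriage.R1K3
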